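import Summits.HubbardSuperconductivity.HubbardSuperconductivity.Theorems.AnisotropyChordTransferFibre3C0Layer
import Summits.HubbardSuperconductivity.HubbardSuperconductivity.Theorems.AnisotropyChordTransferFibre3KT2bTargets

/-!
# Route `AnisotropyChord` / H0 rotor rung: PartN41-C §4 `NC0Split` (content): `‖C0‖² = ‖C0‖²_{W=0} + Sh`, `‖C0′‖² ≤ ‖C0‖²`

Theory-1 g22's PartN41-C §4 `NC0Split` (port …Fibre3KT2bRow pending review): the contact-shell sum
`Sh = Σ_{W ≥ 1} C0²` splits off `‖C0‖²` by `W = 0 / W ≠ 0` (★ `nC0_split`), and `‖C0′‖² ≤ ‖C0‖²` (★ `nC0p_le_nC0`) by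
`C0PrimePythagoras` (`c0PrimePythagoras_holds`) once `|C0′(c)|² = (C0(c) − (T⁺ − 3λ₂)Π⁰(c))²` (★ `normSq_C0p_eq`: at `K = 0`
the Hamiltonian of the real product state is real, `Happly_zero_prodState`).  ★ `nC0Split_content` = the body of `NC0Split L Δ`
with `nC0shell` spelled out.
Prover seat `hubbard-h0-rotor-p1` g26 (route lead); helper for stmt-HubbardSuperconductivity-23918 (`--supports`, helper class).
WHAT THIS IS NOT: nothing here proves superconductivity in the Hubbard model; bookkeeping of ONE row of ONE conditional
reduction.  Tree imports only; no new definitions; no sorry, no axioms.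
-/

set_option linter.dupNamespace false
set_option autoImplicit false

noncomputable section

open scoped BigOperators

namespace Summit.HubbardSuperconductivity.HubbardSuperconductivity.Theorems.AnisotropyChord.Transfer.Fibre3

variable (L : ℕ) [NeZero L]

namespace ShellRow

/-- `‖C0‖² = ‖C0‖²_{W=0} + Σ_{W ≠ 0} C0²`. [folklore] -/
theorem nC0_split (Δ lam2 : ℝ) (f : Tor L → ℝ) :
    nC0 L Δ lam2 f = nC0free L Δ lam2 f
      + ∑ c ∈ Finset.univ.filter (fun c : Cfg L => Wcount L c ≠ 0), C0fn L Δ lam2 f c ^ 2 := by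
  classical
  unfold nC0 nC0free
  rw [← Finset.sum_filter_add_sum_filter_not Finset.univ (fun c : Cfg L => Wcount L c = 0)]

/-- `|C0′(c)|² = (C0(c) − (T⁺ − 3λ₂)Π⁰(c))²` for a two-magnon profile. [folklore] -/
theorem normSq_C0p_eq {Δ lam2 : ℝ} {f : Tor L → ℝ} (hf : IsTwoMagnon L Δ lam2 f) (c : Cfg L) :
    Complex.normSq (C0p L Δ f c) = (C0fn L Δ lam2 f c - (Tplus L Δ f - 3 * lam2) * piR L f c) ^ 2 := by
  unfold C0p C0fn
  split_ifs with hc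
  · rw [piR_D L hf.1 c hc]; simp
  · rw [Happly_zero_prodState_re, Happly_zero_prodState, prodState_eq_piR, ← Complex.ofReal_mul,
      ← Complex.ofReal_sub, Complex.normSq_ofReal]
    ring

/-- `‖C0′‖² ≤ ‖C0‖²` (`C0PrimePythagoras`). [folklore] -/
theorem nC0p_le_nC0 {Δ lam2 : ℝ} {f : Tor L → ℝ} (hf : IsTwoMagnon L Δ lam2 f) : nC0p L Δ f ≤ nC0 L Δ lam2 f := by
  have hP := c0PrimePythagoras_holds L Δ lam2 f hf
  have e : nC0p L Δ f = ∑ c : Cfg L, (C0fn L Δ lam2 f c - (Tplus L Δ f - 3 * lam2) * piR L f c) ^ 2 := by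
    unfold nC0p
    exact Finset.sum_congr rfl fun c _ => normSq_C0p_eq L hf c
  rw [e, hP]
  have : 0 ≤ PiNormSq L f := by unfold PiNormSq; positivity
  nlinarith [sq_nonneg (Tplus L Δ f - 3 * lam2)]

/-- ★ the body of `NC0Split L Δ` with `nC0shell` spelled out. [folklore] -/
theorem nC0Split_content {Δ lam2 : ℝ} {f : Tor L → ℝ} (hf : IsTwoMagnon L Δ lam2 f) :
    nC0 L Δ lam2 f = nC0free L Δ lam2 f
        + (∑ c ∈ Finset.univ.filter (fun c : Cfg L => Wcount L c ≠ 0), C0fn L Δ lam2 f c ^ 2) ∧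
      nC0p L Δ f ≤ nC0 L Δ lam2 f :=
  ⟨nC0_split L Δ lam2 f, nC0p_le_nC0 L hf⟩

end ShellRow

end Summit.HubbardSuperconductivity.HubbardSuperconductivity.Theorems.AnisotropyChord.Transfer.Fibre3

end
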